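import Summits.KontsevichZagierPeriods.KontsevichZagierPeriods.Theorems.RootDecompZetaThreeFrontierThreeLayerP7
import Summits.KontsevichZagierPeriods.KontsevichZagierPeriods.Theorems.RootDecompZetaThreeFrontierWordMatchPreludeP17
import Summits.KontsevichZagierPeriods.KontsevichZagierPeriods.Theorems.RootDecompZetaThreeFrontierGZLadderThreeOrders

/-! # `RootDecompZetaThreeFrontierGZLadderRungThree` — decomp-kz lens-1 g12 §48: the COMPOSITION of the registered skeleton «gz_ladder» v4
(`HOME/decomp-kz-writer-1/g6/a6/gz/gz_ladder32433_v4.lean`, composition l.186–257 verbatim up to the namespace) over the LANDED stubs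
`stub_le_two` (GZLadderLeTwo), `stub_three_wlog` (GZLadderThreeWlog), `stub_three_orders` (GZLadderThreeOrders),
`stub_three_match_of_gapClassMatch` (WordMatchPreludeP6), `stub_gapClassMatch` (WordMatchPreludeP17) and `stub_three_layer` (ThreeLayerP7):
PROVES the support item stmt-KontsevichZagierPeriods-32433 `…Theses.RootDecompZetaThreeFrontier.GZNormalFormWThree` outright (rung 3 of the genus-zero
ladder; one-environment certificate `HOME/decomp-kz-lens-1/g12/Kernel28709_v1.lean` sha256 4904f6c7…, std axioms).  The crux corollary
(stmt-KontsevichZagierPeriods-28709 `GenusZeroThreeNormalForm` through the landed transfer edge `…WordEdge.stub_transfer`) is landed separately in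
`RootDecompZetaThreeFrontierGenusZeroThreeNormalForm.lean` (landing edit by census-1 g9: one item per closing file). -/

set_option linter.dupNamespace false

noncomputable section

namespace Summit.KontsevichZagierPeriods.KontsevichZagierPeriods.Cruxes.GZNormalFormWThree.GZLadder.RungThree

open Set MeasureTheory Literature.NumberTheory.Transcendental
open Summit.KontsevichZagierPeriods.RootDecompZetaThreeFrontier


/-- Auxiliary step `words_mono`: words mono. [bookkeeping] -/
theorem words_mono {k K : ℕ} (h : k ≤ K) : words k ⊆ words K := by
  rintro x ⟨w, ε, q, s, hw, hd, hi, rfl⟩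
  exact ⟨w, ε, q, s, hw.trans h, hd, hi, rfl⟩

/-- Auxiliary step `congInto_mono`: cong Into mono. [bookkeeping] -/
theorem congInto_mono {S T : Set KZ.FormalRep} (h : S ⊆ T) {x : KZ.FormalRep} (hx : CongInto S x) : CongInto T x := by
  obtain ⟨m, hm, hr⟩ := hx
  exact ⟨m, AddSubgroup.closure_mono h hm, hr⟩

/-- if every generator of `S` is congruent into `closure T`, so is every element of `closure S` -/
theorem congInto_of_mem_closure {S T : Set KZ.FormalRep} (hS : ∀ x ∈ S, CongInto T x) {c : KZ.FormalRep}
    (hc : c ∈ AddSubgroup.closure S) : CongInto T c := by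
  induction hc using AddSubgroup.closure_induction with
  | mem x hx => exact hS x hx
  | zero => exact ⟨0, zero_mem _, by simp⟩
  | add x y _ _ ihx ihy =>
    obtain ⟨m₁, hm₁, h₁⟩ := ihx
    obtain ⟨m₂, hm₂, h₂⟩ := ihy
    refine ⟨m₁ + m₂, add_mem hm₁ hm₂, ?_⟩
    have key := add_mem h₁ h₂
    rwa [show x - m₁ + (y - m₂) = x + y - (m₁ + m₂) by abel] at key
  | neg x _ ih =>
    obtain ⟨m, hm, h⟩ := ih
    refine ⟨-m, neg_mem hm, ?_⟩
    have key := neg_mem h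
    rwa [show -(x - m) = -x - -m by abel] at key

/-- transitivity: `x ≡ m` and `m` congruent into `closure T` -/
theorem congInto_of_sub_mem {T : Set KZ.FormalRep} {x m : KZ.FormalRep} (h : x - m ∈ KZ.relations) (hm : CongInto T m) :
    CongInto T x := by
  obtain ⟨m', hm', h'⟩ := hm
  refine ⟨m', hm', ?_⟩
  have key := add_mem h h'
  rwa [sub_add_sub_cancel] at key

/-! ## The composition (PROVED): the five stubs give the crux BY NAME -/

/-- rung ≤ 2 absorbs the dimension-≤-2 boundary classes -/
theorem congInto_words_three
    (h₂ : ∀ k ≤ 2, ∀ r : KZ.IntegralRep k, IsGZ k r → CongInto (words k) (KZ.of r))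
    {x : KZ.FormalRep} (hx : CongInto (words 3 ∪ gzLETwo) x) : CongInto (words 3) x := by
  obtain ⟨m, hm, hrel⟩ := hx
  refine congInto_of_sub_mem hrel (congInto_of_mem_closure (fun y hy => ?_) hm)
  rcases hy with hy | ⟨k, s, hk, hs, rfl⟩
  · exact ⟨y, AddSubgroup.subset_closure hy, by simp⟩
  · exact congInto_mono (words_mono (by omega)) (h₂ k hk s hs)

/-- rung 3 of the ladder from stubs 2–5 -/
theorem rung_three
    (h₂ : ∀ k ≤ 2, ∀ r : KZ.IntegralRep k, IsGZ k r → CongInto (words k) (KZ.of r))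
    (h₃ : ∀ r : KZ.IntegralRep 3, IsGZ 3 r → IsReducedThree r)
    (h₄ : ∀ r : KZ.IntegralRep 3, IsReducedThree r → CongInto (layerThree ∪ gzLETwo) (KZ.of r))
    (h₅ : ∀ s : KZ.IntegralRep 3, IsLayerThree s → CongInto (words 3 ∪ gzLETwo) (KZ.of s))
    (r : KZ.IntegralRep 3) (hr : IsGZ 3 r) : CongInto (words 3) (KZ.of r) := by
  obtain ⟨m, hm, hrel⟩ := h₄ r (h₃ r hr)
  refine congInto_of_sub_mem hrel (congInto_of_mem_closure (fun x hx => ?_) hm)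
  rcases hx with ⟨s, hs, rfl⟩ | ⟨k, s, hk, hs, rfl⟩
  · exact congInto_words_three h₂ (h₅ s hs)
  · exact congInto_mono (words_mono (by omega)) (h₂ k hk s hs)

/-- `stub_three_match` of «gz_ladder» v4, now a THEOREM: landed P6 edge ∘ `stub_gapClassMatch` (§46) -/
theorem three_match : ∀ r : KZ.IntegralRep 3, IsReducedOrdThree r → CongInto (layerThree ∪ gzLETwo) (KZ.of r) :=
  stub_three_match_of_gapClassMatch stub_gapClassMatch

/-- `stub_three_reduce` of «gz_ladder» v2: landed `stub_three_orders` then `three_match` -/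
theorem three_reduce : ∀ r : KZ.IntegralRep 3, IsReducedThree r → CongInto (layerThree ∪ gzLETwo) (KZ.of r) :=
  fun r hr => three_match r (stub_three_orders r hr)

/-- **ITEM 32433 `GZNormalFormWThree` OUTRIGHT** (the composition `GZNormalFormWThree_of` of «gz_ladder» v4 with all five stubs now theorems:
`stub_le_two` [landed], `stub_three_wlog` [landed], `stub_three_orders` [landed], `stub_gapClassMatch` [§46], `stub_three_layer` [§47]). -/
theorem GZNormalFormWThree_kernel :
    Summit.KontsevichZagierPeriods.KontsevichZagierPeriods.Theses.RootDecompZetaThreeFrontier.GZNormalFormWThree := by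
  intro k hk r p a b c hd hi
  have hgz : IsGZ k r := ⟨hd, p, a, b, c, hi⟩
  rcases Nat.lt_or_ge k 3 with hlt | hge
  · exact stub_le_two k (by omega) r hgz
  · obtain rfl : k = 3 := le_antisymm hk hge
    exact rung_three stub_le_two stub_three_wlog three_reduce stub_three_layer r hgz

end Summit.KontsevichZagierPeriods.KontsevichZagierPeriods.Cruxes.GZNormalFormWThree.GZLadder.RungThree

end
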